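import Summits.QuantumFields.YangMills.Theorems.BalabanUVNodesN10AtRecord11
import Literature.MathematicalPhysics.QuantumFieldTheory.Balaban1983to89.B13NodeTorusWalksAccretive

/-!
# BalabanUVNodes ∕ N10 AT THE B13-RE-BOUND STAGE-11 VIEW FROM THE W-WALKS RUNG — [Balaban1988RG2Cluster] Lemmas 1–3 (`Dag.B13_main`)
# at a run of a world bound at NODE 00's Stage-11 view with the B13 group re-bound to a two-scale torus step (dag-n10-d's
# `BalabanUVNodesN10AtRecord11`, p451777), Lemma 3's kernel inputs DISCHARGED from the displayed hypothesis `UniformWalksAcross 𝓣 q`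
# (dag-n10-c's `B13NodeTorusWalks(Accretive)`, p451225 ∕ the sibling): the s2 ⊕ s3 junction of FAN-OUT v1.1 §N10, ONE application

HONEST FRAMING.  Count-neutral kernel bookkeeping over LANDED modules (Track A, DAG node N10 [B13]; seat `pub-ymgap-dag-n10-c`, strategy s3
«located caveat admitted as hypothesis»); N10 is NOT discharged; nothing of Bałaban's is asserted.  What a discharge still needs stays displayed:
(P) NODE 00's pin object `CarriersB13` (the two-scale torus step of record built from the term tower — it instantiates the GENERIC re-binding
`S P := (Wt P).toStepData` and the kernel family `idx` ∕ `uOf` here by unification), (A) NODE A's OBJECT content — now in ONE Prop: the W-walks rung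
`UniformWalksAcross 𝓣_Bałaban q` for HIS kernels ([Balaban1985BackgroundPropagators] Thm 3.10, k-uniform at complex backgrounds = in-edge N06 ∕
FAN-OUT §N06 s4), plus NODE A's structural inputs (complex symmetry of the term precision, the linear-map reading, separate holomorphy, termwise
domination, `Γ₀`'s form bound) and numbers; (B) the located per-term inputs of Lemmas 1–2 incl. the in-edges (1.24)∕(1.30) ([I] (3.54), (3.17);
[15] Prop. 4).  One finite four-torus programme at fixed ε per run; nothing continuum ∕ ℝ⁴ ∕ OS ∕ mass-gap ∕ Clay.  0 `sorry`, 0 `def`, standard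
axioms.  Filed `--supports` K1 «StabilityBAtRecordR11e» (stmt-QuantumFields-19674) of route «BalabanUVNodes».

WHAT THIS FILE PROVES.  ONE theorem, **`b13_main_at_stage11_twoTorus_uniformWalksAcross`**: at a run `P` of a world `w` bound at the B13-re-bound
Stage-11 view `θ₁₁.toStage5₁₁.rebindX (fun P => { θ₁₁.res.X P with S13 := S P, c13 := c })` (n10-d's `b13_main_at_stage11_rebindS13`, whose leaf-triple
hypothesis is supplied), with the run's pinned step data the record of a two-scale torus step `Wt` on the torus of a member `s₀` of ANY family
`𝓣 : Sι → TorusTerms c 4` carrying `UniformWalksAcross 𝓣 q` (ONE admissible package with positive rates, `η ≤ etaMax`), print's two smallness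
thresholds for a `θ₀ > 0`, and the binders of `B13NodeTorusWalksAccretive.b13Leaf_twoTorus_uniformWalksAcross₂` (Lemma 1's data with the in-edges,
Lemma 2's data, Lemma 3's numerics, parameter domains, the dictionary `idx`∕`uOf`, per-term lists ∕ characteristic functions ∕ potentials, termwise
domination, separate holomorphy, complex symmetry `hAs`, `hlin`, round letters, rate chain, `ϑ`, the (2.24)–(2.25) smallness with `1∕m_A ≤ c_E`, the
p. 17 matching): `Dag.B13_main (leavesP w P)`.  Proof: `b13_main_at_stage11_rebindS13` ∘ `b13Leaf_twoTorus_uniformWalksAcross₂`.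
-/

noncomputable section

namespace Summit.QuantumFields.YangMills.BalabanUVNodes.N10AtRecord11Walks

open Metric Set
open Literature.MathematicalPhysics.QuantumFieldTheory.Balaban1983to89
open Literature.MathematicalPhysics.QuantumFieldTheory.Balaban1983to89.T4Continuum
open Literature.MathematicalPhysics.QuantumFieldTheory.Balaban1983to89.DagBinding
open Literature.MathematicalPhysics.QuantumFieldTheory.Balaban1983to89.Node00
open Literature.MathematicalPhysics.QuantumFieldTheory.Balaban1983to89.B16Absorption (pbox)
open Literature.MathematicalPhysics.QuantumFieldTheory.Balaban1983to89.TreeLengthTorus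
open Literature.MathematicalPhysics.QuantumFieldTheory.Balaban1983to89.TreeLengthTorusGeometry
open Literature.MathematicalPhysics.QuantumFieldTheory.Balaban1983to89.TreeLengthTorusTransfer
open Literature.MathematicalPhysics.QuantumFieldTheory.Balaban1983to89.B12TreeDecay (kappa₀ K₀)
open Literature.MathematicalPhysics.QuantumFieldTheory.Balaban1983to89.B13Lemma3TorusData
open Literature.MathematicalPhysics.QuantumFieldTheory.Balaban1983to89.B13Lemma3Torus (TwoTorusStep)
open Literature.MathematicalPhysics.QuantumFieldTheory.Balaban1983to89.B13Lemma3TorusSocket (Lemma3Numerics)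
open Literature.MathematicalPhysics.QuantumFieldTheory.Balaban1983to89.B13PkScaling (Qop scaled)
open Literature.MathematicalPhysics.QuantumFieldTheory.Balaban1983to89.B13Bound143 (invTau R12)
open Literature.MathematicalPhysics.QuantumFieldTheory.Balaban1983to89.B13Term214 (term214 SepHolOn core214 F214)
open Literature.MathematicalPhysics.QuantumFieldTheory.Balaban1983to89.B13Lemma3TorusTerms (terms weight Z0)
open Literature.MathematicalPhysics.QuantumFieldTheory.Balaban1983to89.B5TorusCover (UT)
open Literature.MathematicalPhysics.QuantumFieldTheory.Balaban1983to89.B9Thm37GlueTorus (tdist1)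
open Literature.MathematicalPhysics.QuantumFieldTheory.Balaban1983to89.B13TermWalkData (TermKernels TorusTerms)
open Literature.MathematicalPhysics.QuantumFieldTheory.Balaban1983to89.NodeOLettersOfWalksAcross
  (WalkPackage RateBook TermWalks UniformWalksAcross)
open Literature.MathematicalPhysics.QuantumFieldTheory.Balaban1983to89.B13NodeTorusWalksAccretive
  (b13Leaf_twoTorus_uniformWalksAcross₂)
open Summit.QuantumFields.YangMills.BalabanUVNodes.N10AtRecord11 (b13_main_at_stage11_rebindS13)

variable (F : T4Family) (N : ℕ) [NeZero N]

open Matrix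

open Classical in
/-- **N10 AT THE B13-RE-BOUND STAGE-11 VIEW, LEMMA 3's KERNEL INPUTS FROM THE DISPLAYED HYPOTHESIS `UniformWalksAcross 𝓣 q`.**  At a run `P` of a
world `w` bound at the Stage-11 view of `θ₁₁` with the B13 group re-bound to `(S P, c)` (`hup`), the pinned step data being the record of a two-scale
torus step `Wt` (`hS`) on the torus of a member `s₀` of a family `𝓣` of (2.14)-term kernel data carrying the W-walks rung with ONE package `q`
(`hall`; `q` admissible with positive rates, `η ≤ etaMax q`), the (2.14)-terms of `Wt` listed by `idx` and read at the configurations `uOf` of size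
`≤ α`: Lemma 1's located per-term inputs (index data of (1.33), analyticity, thresholds, R8∕R9, the in-edges (1.24)∕(1.30) BY REFERENCE to [I] (3.54),
(3.17), [15] Prop. 4, the constants with headroom), Lemma 2's (V″_k = V′_k + local pieces, per-cube scaled cubic terms, identifications, floor,
gauge invariance by assertion), Lemma 3's numerics bundle, Cauchy radius and parameter domains, per-term parameter lists, (2.3) characteristic
functions, sub-families and potentials through the embedding of the real field, termwise domination, separate holomorphy, NODE A's structural
inputs `hAs` (complex symmetry on the polydisc) and `hlin`, uniform fibre bounds, round letters `K̄ ≤ K_G`, `4∕m_A ≤ K_Cs`, print's two thresholds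
`α ≤ θ₀R∕(4K̄+4)`, `R_σ ≥ log((4K̄+4)∕θ₀)∕(μ∕4 − κ_C⋆)` for a `θ₀ > 0`, the rate chain `0 < κ″ < κ′ < κ < κ₂ < κ_C⋆`, NODE A's letter `ϑ`, the
(2.24)–(2.25) smallness with `1∕m_A ≤ c_E`, `Γ₀`'s form bound and the p. 17 matching GIVE `Dag.B13_main (leavesP w P)`.  Proof: n10-d's
`b13_main_at_stage11_rebindS13` fed with `B13NodeTorusWalksAccretive.b13Leaf_twoTorus_uniformWalksAcross₂`.  The count moves only when `S` ∕ `idx` ∕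
`uOf` are NODE 00's objects of record (`CarriersB13`) and the rung is a theorem about Bałaban's kernels (NODE A ∕ in-edge N06).
[cite: Balaban1988RG2Cluster, Lemmas 1–3 pp.9, 11, 20; p.13, p.15, (2.14)–(2.26) pp.15–17; Balaban1985BackgroundPropagators, Thm 3.10 p.416] -/
theorem b13_main_at_stage11_twoTorus_uniformWalksAcross
    -- (0) the Stage-11 parameters, the pinned step data `S` with ONE constants record `c`, the run bound at the B13-re-bound view
    (θ₁₁ : Stage11Params F N) (S : B12.RunParams → B13.StepData) (c : B13.Consts) (w : WorldP) (P : B12.RunParams)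
    (hup : w.up P = upOfRecord₅C F N ((θ₁₁.toStage5₁₁ F N).rebindX F N fun P => { θ₁₁.res.X P with S13 := S P, c13 := c }) P)
    -- (0′) the family carrying the rung; the member `s₀` on whose torus the run's pinned step data is a two-scale torus step
    {Sι : Type*} (𝓣 : Sι → TorusTerms c 4) {q : WalkPackage} (hall : UniformWalksAcross 𝓣 q)
    (s₀ : Sι) [NeZero (𝓣 s₀).N'] {L : ℕ} [NeZero L] (Wt : TwoTorusStep 4 L (𝓣 s₀).N') (hS : S P = Wt.toStepData)
    (k : ℕ) (hN12 : 12 ≤ L * (𝓣 s₀).N') (hL8 : 8 ≤ c.L) (hLc : c.L = L)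
    -- (1) LEMMA 1: index data of (1.33)
    (S0 : TDom 4 (L * (𝓣 s₀).N') → Finset (TPt 4 (L * (𝓣 s₀).N')))
    (Fc : TDom 4 (L * (𝓣 s₀).N') → TPt 4 (L * (𝓣 s₀).N') → Finset (TPt 4 (L * (𝓣 s₀).N')))
    (Sq : TDom 4 (L * (𝓣 s₀).N') → TPt 4 (L * (𝓣 s₀).N') → (j : ℕ) → Finset (TPt 4 (L ^ (k - j) * (L * (𝓣 s₀).N'))))
    (SX : TDom 4 (L * (𝓣 s₀).N') → TPt 4 (L * (𝓣 s₀).N') → (j : ℕ) → TPt 4 (L ^ (k - j) * (L * (𝓣 s₀).N')) →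
      Finset (TDom 4 (L ^ (k - j) * (L * (𝓣 s₀).N'))))
    (T : TDom 4 (L * (𝓣 s₀).N') → TPt 4 (L * (𝓣 s₀).N') → Finset (TPt 4 (L * (𝓣 s₀).N')) → (j : ℕ) →
      TPt 4 (L ^ (k - j) * (L * (𝓣 s₀).N')) → TDom 4 (L ^ (k - j) * (L * (𝓣 s₀).N')) → Wt.Φ → ℂ)
    (Sc : TDom 4 (L * (𝓣 s₀).N') → Finset (TPt 4 (L * (𝓣 s₀).N')))
    (Sq' : TDom 4 (L * (𝓣 s₀).N') → TPt 4 (L * (𝓣 s₀).N') → (j : ℕ) → Finset (TPt 4 (L ^ (k - j) * (L * (𝓣 s₀).N'))))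
    (SX' : TDom 4 (L * (𝓣 s₀).N') → TPt 4 (L * (𝓣 s₀).N') → (j : ℕ) → TPt 4 (L ^ (k - j) * (L * (𝓣 s₀).N')) →
      Finset (TDom 4 (L ^ (k - j) * (L * (𝓣 s₀).N'))))
    (T' : TDom 4 (L * (𝓣 s₀).N') → TPt 4 (L * (𝓣 s₀).N') → (j : ℕ) → TPt 4 (L ^ (k - j) * (L * (𝓣 s₀).N')) →
      TDom 4 (L ^ (k - j) * (L * (𝓣 s₀).N')) → Wt.Φ → ℂ)
    (dist : TDom 4 (L * (𝓣 s₀).N') → TPt 4 (L * (𝓣 s₀).N') → (j : ℕ) → TPt 4 (L ^ (k - j) * (L * (𝓣 s₀).N')) → ℝ) {K K' : ℝ}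
    (h133 : ∀ Y, Wt.Vp Y =
      (∑ a ∈ S0 Y, ∑ X ∈ (Fc Y a).powerset, ∑ j ∈ Finset.range (k + 1), ∑ q ∈ Sq Y a j,
        ∑ x ∈ SX Y a j q, T Y a X j q x) +
      (∑ a ∈ Sc Y, ∑ j ∈ Finset.range (k + 1), ∑ q ∈ Sq' Y a j, ∑ x ∈ SX' Y a j q, T' Y a j q x))
    (hS0Y : ∀ Y, ∀ a ∈ S0 Y,
      (pbox (fun i => natLift a i - (5 : ℕ)) (fun i => natLift a i + 1 + (5 : ℕ))).image (proj (L * (𝓣 s₀).N')) ⊆ Y.1)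
    (hFsub : ∀ Y a, Fc Y a ⊆
      (pbox (fun i => natLift a i - (5 : ℕ)) (fun i => natLift a i + 1 + (5 : ℕ))).image (proj (L * (𝓣 s₀).N')) \
        (pbox (fun i => natLift a i - (4 : ℕ)) (fun i => natLift a i + 1 + (4 : ℕ))).image (proj (L * (𝓣 s₀).N')))
    (hSq : ∀ Y, ∀ a ∈ S0 Y, ∀ j, Sq Y a j ⊆ (Finset.univ : Finset (TPt 4 (L ^ (k - j) * (L * (𝓣 s₀).N')))).filter
      (fun q => tcoarse (L ^ (k - j)) (L * (𝓣 s₀).N') q ∈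
        (pbox (fun i => natLift a i - (2 : ℕ)) (fun i => natLift a i + 1 + (2 : ℕ))).image (proj (L * (𝓣 s₀).N'))))
    (hScY : ∀ Y, Sc Y ⊆ Y.1)
    (hdist0 : ∀ Y a j q, 0 ≤ c.δ₀ * dist Y a j q)
    (hdist : ∀ Y a j (n : ℕ) q, q ∉ (pbox (fun i => ((L ^ (k - j) : ℕ) : ℤ) * natLift a i - (n + 1 : ℕ))
      (fun i => ((L ^ (k - j) : ℕ) : ℤ) * natLift a i + 2 * ((L ^ (k - j) : ℕ) : ℤ) - 1 + (n + 1 : ℕ))).image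
        (proj (L ^ (k - j) * (L * (𝓣 s₀).N'))) → c.δ₀ * c.M * ((n : ℝ) + 1) ≤ c.δ₀ * dist Y a j q)
    (hSX : ∀ Y a j q, SX Y a j q ⊆ (tcubeSys 4 (L ^ (k - j) * (L * (𝓣 s₀).N'))).above q)
    (hSX' : ∀ Y a j q, SX' Y a j q ⊆ (tcubeSys 4 (L ^ (k - j) * (L * (𝓣 s₀).N'))).above q)
    (hX0 : ∀ Y, ∀ a ∈ Sc Y, ∀ j ∈ Finset.range (k + 1), ∀ q ∈ Sq' Y a j, ∀ x ∈ SX' Y a j q,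
      x.1.image (tcoarse (L ^ (k - j)) (L * (𝓣 s₀).N')) ⊆ Y.1)
    -- (1) LEMMA 1: analyticity of the terms, closure of `Analytic`
    (hAdd : ∀ (s : Set Wt.Φ) (f g : Wt.Φ → ℂ), Wt.Analytic f s → Wt.Analytic g s → Wt.Analytic (f + g) s)
    (hZero : ∀ s : Set Wt.Φ, Wt.Analytic 0 s)
    (hAnT : ∀ Y, ∀ a ∈ S0 Y, ∀ X ∈ (Fc Y a).powerset, ∀ j ∈ Finset.range (k + 1), ∀ q ∈ Sq Y a j,
      ∀ x ∈ SX Y a j q, Wt.Analytic (T Y a X j q x) (Wt.sp1 Y))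
    (hAnT' : ∀ Y, ∀ a ∈ Sc Y, ∀ j ∈ Finset.range (k + 1), ∀ q ∈ Sq' Y a j, ∀ x ∈ SX' Y a j q,
      Wt.Analytic (T' Y a j q x) (Wt.sp1 Y))
    -- (1) LEMMA 1: thresholds and restrictions
    (hK : 0 ≤ K) (hK' : 0 ≤ K') (hκ : 0 ≤ c.κ) (hδ1 : c.δ < 1) (hδκ : 1 ≤ c.δ * c.κ)
    (hκ126 : kappa₀ 64 8 ≤ c.κ) (hκ126' : kappa₀ 64 8 ≤ c.δ * c.κ)
    (hκ₁ : 1 + 2 * Real.log (8 * 12 ^ 3) ≤ c.κ₁) (hκ₁' : 2 + 16 * Real.log 128 ≤ c.κ₁)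
    (hδ₀M : 10 * Real.exp (-1) ≤ c.δ₀ * c.M) (hδ₀M5 : 2 * Real.log 5 ≤ c.δ₀ * c.M)
    (hR8 : (1 - c.δ) * c.κ ≤ (1 / 4) * (c.κ₁ - 1)) (hR9 : (1 - 2 * c.δ) * c.κ ≤ (1 / 16) * c.κ₁)
    -- (1) LEMMA 1: per-term (1.24), (1.30) (IN-EDGES); the constants of (1.36) with headroom (1 − θ) for the local pieces
    (h124 : ∀ Y φ, φ ∈ Wt.sp1 Y → ∀ a ∈ S0 Y, ∀ X ∈ (Fc Y a).powerset, ∀ j ∈ Finset.range (k + 1), ∀ q ∈ Sq Y a j,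
      ∀ x ∈ SX Y a j q,
        ‖T Y a X j q x φ‖ ≤ K * ((L : ℝ) ^ j * ((L : ℝ) ^ k)⁻¹) ^ 5 *
          Real.exp (-(c.κ₁ - 1) *
            (((Y.1 \ (pbox (fun i => natLift a i - (5 : ℕ)) (fun i => natLift a i + 1 + (5 : ℕ))).image
              (proj (L * (𝓣 s₀).N'))).card : ℝ) + X.card)) *
          Real.exp (-(c.κ * torusTreeLen x.1)))
    (h130 : ∀ Y φ, φ ∈ Wt.sp1 Y → ∀ a ∈ Sc Y, ∀ j ∈ Finset.range (k + 1), ∀ q ∈ Sq' Y a j,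
      ∀ x ∈ SX' Y a j q,
        ‖T' Y a j q x φ‖ ≤ K' * Real.exp (-(1 / 2) * (c.δ₀ * c.M) * ((L : ℝ) ^ j * ((L : ℝ) ^ k)⁻¹)⁻¹
            - (1 / 2) * c.δ₀ * dist Y a j q) *
          Real.exp (-(c.κ₁ - 1) * ((Y.1 \ x.1.image (tcoarse (L ^ (k - j)) (L * (𝓣 s₀).N'))).card : ℝ)) *
          Real.exp (-(c.κ * torusTreeLen x.1)))
    {θ : ℝ} (hθ0 : 0 ≤ θ) (hθ1 : θ < 1)
    (hC : K * K₀ 64 8 * (2 * (6 * (L : ℝ)) ^ 4) * Real.exp 1 * Real.exp ((1 / 8) * c.κ₁ * (12 ^ 4 - 1)) +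
        2 * (64 * K') * K₀ 64 8 * 1344 ≤
      (1 - θ) * (c.E₀ * c.ε₁ * c.C₁ * c.M ^ c.q * Real.exp (c.C₂ * c.κ₁)))
    -- (2) LEMMA 2 (pp. 10–11): V″_k = V′_k + the local pieces G of P^{(k)}, analytic and (1.36)-small at prefactor θ
    (Gl : TDom 4 (L * (𝓣 s₀).N') → Wt.Φ → ℂ) (hVpp : ∀ Y, Wt.Vpp Y = fun φ => Wt.Vp Y φ + Gl Y φ)
    (hGlAn : ∀ Y, Wt.Analytic (Gl Y) (Wt.sp1 Y))
    (hGl : ∀ Y φ, φ ∈ Wt.sp1 Y → ‖Gl Y φ‖ ≤ θ * (c.E₀ * c.ε₁ * c.C₁ * c.M ^ c.q * Real.exp (c.C₂ * c.κ₁)) *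
      Real.exp (-((1 - 2 * c.δ) * c.κ * (tsys 4 (L * (𝓣 s₀).N')).dj Y)))
    -- (2) LEMMA 2: the located per-term data of `B13Lemma2Torus.lemma2Printed_twoTorus'`
    {E : Type*} [NormedAddCommGroup E] [NormedSpace ℂ E]
    (rd : TDom 4 (L * (𝓣 s₀).N') → Wt.Φ → E) (e : TDom 4 (L * (𝓣 s₀).N') → Wt.Bond → E) (he : ∀ Y b, ‖e Y b‖ ≤ 1)
    (hrd : ∀ Y φ, rd Y φ = haveI := Wt.finBond; ∑ b, Wt.Bv φ b • e Y b)
    {ι₂ : Type*} (s : TDom 4 (L * (𝓣 s₀).N') → Finset ι₂) (Wf : TDom 4 (L * (𝓣 s₀).N') → ι₂ → Wt.Φ → E → ℂ) {g : ℂ} (hg : g ≠ 0)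
    {R K₂ : ℝ} {m₂ : ℕ} (hK₂ : 0 ≤ K₂) (hR : 0 < R) (h3 : 3 * c.ε₁ ≤ R)
    (hW : ∀ Y, ∀ i ∈ s Y, ∀ φ ∈ Wt.sp1 Y, AnalyticOnNhd ℂ (Wf Y i φ) (ball 0 R))
    (hKW : ∀ Y, ∀ i ∈ s Y, ∀ φ ∈ Wt.sp1 Y, ∀ z ∈ ball (0 : E) R,
      ‖Wf Y i φ z‖ ≤ K₂ * Real.exp (-(c.κ₁ - 1) * ((Y.1.card : ℝ) - 1)) * ‖z‖ ^ 3)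
    (hcard : ∀ Y, (s Y).card ≤ m₂ * Y.1.card)
    (hV : ∀ Y, Wt.V Y = fun φ => (∑ i ∈ s Y, scaled g (Wf Y i φ) (rd Y φ)) + Wt.Vpp Y φ)
    (hQ : ∀ Y φ (b b' : Wt.Bond), φ ∈ Wt.sp1 Y →
      Wt.Q Y φ b b' = 2 * ∑ i ∈ s Y, Qop (scaled g (Wf Y i φ)) (rd Y φ) (e Y b) (e Y b'))
    (hsp : ∀ Y φ, φ ∈ Wt.sp1 Y → ‖g‖ * ‖rd Y φ‖ < c.ε₁)
    (hvolk : ∀ Y, Wt.volk Y = Y.1.card)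
    (hfloor : 27 * m₂ * K₂ * Real.exp (c.κ₁ - 1) ≤ c.C₃ * c.M ^ 4 * Real.exp (c.C₂ * c.κ₁))
    (hAnP : ∀ Y, ∀ i ∈ s Y, Wt.Analytic (fun φ => scaled g (Wf Y i φ) (rd Y φ)) (Wt.sp1 Y))
    (hG : ∀ Y, Wt.GaugeInv (Wt.V Y) ∧ Wt.GaugeInv (Wt.toStepData.quadForm Y) ∧ Wt.GaugeInv (Wt.Vpp Y))
    -- (3) LEMMA 3 (pp. 14–20): the signs of (2.18)–(2.20), R12, |τ(Y)| ≥ 2, and the numerics bundle at ℓ = ½L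
    (M₃ : ℕ) [NeZero M₃] {a a₂ a₂' a₅ Aabs : ℝ} (hN : Lemma3Numerics c M₃ ((c.L : ℝ) / 2) a a₂ a₂' a₅ Aabs)
    (h12 : R12 c) (hE : 0 < c.E₀) (hε : 0 < c.ε₁) (hC₁ : 0 < c.C₁) (hα : 0 < c.α₄) (hM : 1 ≤ c.M)
    (hτ2 : c.E₀ * c.ε₁ * c.C₁ * c.α₄⁻¹ * c.M ^ c.q * Real.exp (c.C₂ * c.κ₁) ≤ 1 / 2)
    -- (3) the Cauchy radius and the parameter domains (p. 15)
    {Uσ Uτ : Set ℂ} (hUσ : IsOpen Uσ) (hUτ : IsOpen Uτ) (hUexp : Metric.closedBall (0 : ℂ) (Real.exp c.κ₁) ⊆ Uσ)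
    (hUtau : ∀ Y : TDom 4 (L * (𝓣 s₀).N'),
      Metric.closedBall (0 : ℂ) ((invTau c ((tsys 4 (L * (𝓣 s₀).N')).dj Y))⁻¹) ⊆ Uτ)
    {r : ℝ} (hr : 0 < r) (hr' : r ≤ Real.exp c.κ₁ - 1)
    (hsubτ : ∀ x ∈ Set.uIcc (0 : ℝ) 1, Metric.closedBall (x : ℂ) r ⊆ Uτ)
    -- (3) THE DICTIONARY: the (2.14)-term (𝐃, P) = t of Z ∈ 𝐃_{k+1} is the term `idx Z t` of the member `s₀` (its
    --     extra columns finite), read at the configuration `u = uOf Z t φ ∈ (𝓣 s₀).E` of `φ ∈ sp2 Z`, of size ≤ α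
    (idx : TDom 4 (𝓣 s₀).N' → Finset (TDom 4 (L * (𝓣 s₀).N')) × Finset (TBond 4 M₃ (L * (𝓣 s₀).N')) → (𝓣 s₀).ι)
    [∀ Z t, Fintype ((𝓣 s₀).𝒦 (idx Z t)).C₀] [∀ Z t, DecidableEq ((𝓣 s₀).𝒦 (idx Z t)).C₀]
    (uOf : (Z : TDom 4 (𝓣 s₀).N') → (t : Finset (TDom 4 (L * (𝓣 s₀).N')) × Finset (TBond 4 M₃ (L * (𝓣 s₀).N'))) →
      Wt.Φ → (𝓣 s₀).E)
    {α : ℝ} (hαnn : 0 ≤ α) (huα : ∀ Z, ∀ t ∈ terms L M₃ Z, ∀ φ ∈ Wt.sp2 Z, ‖uOf Z t φ‖ ≤ α)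
    -- (3) per term: parameter lists, the linear map Γ(σ), characteristic functions, potentials
    (lZ : TDom 4 (𝓣 s₀).N' → Finset (TDom 4 (L * (𝓣 s₀).N')) × Finset (TBond 4 M₃ (L * (𝓣 s₀).N')) →
      List (TPt 4 (𝓣 s₀).N'))
    (hlZ : ∀ Z, ∀ t ∈ terms L M₃ Z, (lZ Z t).Nodup ∧ (lZ Z t).toFinset = Z.1 \ tclosure L (𝓣 s₀).N' (Z0 M₃ t))
    (lD : TDom 4 (𝓣 s₀).N' → Finset (TDom 4 (L * (𝓣 s₀).N')) × Finset (TBond 4 M₃ (L * (𝓣 s₀).N')) →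
      List (TDom 4 (L * (𝓣 s₀).N')))
    (hlD : ∀ Z, ∀ t ∈ terms L M₃ Z, (lD Z t).Nodup ∧ (lD Z t).toFinset = t.1)
    (Γm : (Z : TDom 4 (𝓣 s₀).N') → (t : Finset (TDom 4 (L * (𝓣 s₀).N')) × Finset (TBond 4 M₃ (L * (𝓣 s₀).N'))) → Wt.Φ →
      (TPt 4 (𝓣 s₀).N' → ℂ) → (((𝓣 s₀).𝒦 (idx Z t)).Λ ⊕ ((𝓣 s₀).𝒦 (idx Z t)).C₀ → ℝ) → (((𝓣 s₀).𝒦 (idx Z t)).Λ → ℂ))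
    (χY₀ χcP : (Z : TDom 4 (𝓣 s₀).N') → (t : Finset (TDom 4 (L * (𝓣 s₀).N')) × Finset (TBond 4 M₃ (L * (𝓣 s₀).N'))) →
      (((𝓣 s₀).𝒦 (idx Z t)).Λ → ℝ) → ℝ)
    (hχ0 : ∀ Z t B, 0 ≤ χY₀ Z t B) (hχ1 : ∀ Z t B, χY₀ Z t B ≤ 1)
    (Pl : (Z : TDom 4 (𝓣 s₀).N') → (t : Finset (TDom 4 (L * (𝓣 s₀).N')) × Finset (TBond 4 M₃ (L * (𝓣 s₀).N'))) → Finset ((𝓣 s₀).𝒦 (idx Z t)).Λ)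
    (hPcard : ∀ Z, ∀ t ∈ terms L M₃ Z, (Pl Z t).card = t.2.card) {rP : ℝ} (hrP : 0 ≤ rP)
    (hχc : ∀ Z t B, χcP Z t B = ∏ b ∈ Pl Z t, (if rP ≤ |B b| then (1 : ℝ) else 0))
    (Dfam : TDom 4 (𝓣 s₀).N' → Finset (TDom 4 (L * (𝓣 s₀).N')) × Finset (TBond 4 M₃ (L * (𝓣 s₀).N')) → Finset (TDom 4 (L * (𝓣 s₀).N')))
    (Vr : (Z : TDom 4 (𝓣 s₀).N') → (t : Finset (TDom 4 (L * (𝓣 s₀).N')) × Finset (TBond 4 M₃ (L * (𝓣 s₀).N'))) → Wt.Φ →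
      TDom 4 (L * (𝓣 s₀).N') → (((𝓣 s₀).𝒦 (idx Z t)).Λ → ℝ) → ℂ)
    -- (3) termwise domination: ‖H(Z)‖ ≤ Σ_{(𝐃,P)} ‖(2.14)‖ on the space of p. 15 ((2.9)/(2.14))
    (hH : ∀ (Z : TDom 4 (𝓣 s₀).N') (φ : Wt.Φ), φ ∈ Wt.sp2 Z → ‖Wt.H Z φ‖ ≤
      ∑ t ∈ terms L M₃ Z, ‖term214 r (lZ Z t) (lD Z t)
        (core214 (fun σ => ((𝓣 s₀).𝒦 (idx Z t)).A2 σ (uOf Z t φ)) (Γm Z t φ)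
          (F214 t.2.card (χY₀ Z t) (χcP Z t) (Dfam Z t) (Vr Z t φ))) 0 0‖)
    -- (3) the record's objects behind the terms: bonds, cubes, the real field inside the configurations
    (ιb : (Z : TDom 4 (𝓣 s₀).N') → (t : Finset (TDom 4 (L * (𝓣 s₀).N')) × Finset (TBond 4 M₃ (L * (𝓣 s₀).N'))) → ((𝓣 s₀).𝒦 (idx Z t)).Λ → Wt.Bond)
    (hι : ∀ Z t, Function.Injective (ιb Z t)) (cube : Wt.Bond → TPt 4 (L * (𝓣 s₀).N'))
    (hQsupp : ∀ (Y : TDom 4 (L * (𝓣 s₀).N')) φ b b', Wt.Q Y φ b b' ≠ 0 → cube b ∈ Y.1 ∧ cube b' ∈ Y.1)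
    {m' : ℕ} (hfibc : ∀ Z t (x : TPt 4 (L * (𝓣 s₀).N')), (Finset.univ.filter fun j => cube (ιb Z t j) = x).card ≤ m')
    (emb : (Z : TDom 4 (𝓣 s₀).N') → (t : Finset (TDom 4 (L * (𝓣 s₀).N')) × Finset (TBond 4 M₃ (L * (𝓣 s₀).N'))) → Wt.Φ →
      (((𝓣 s₀).𝒦 (idx Z t)).Λ → ℝ) → Wt.Φ)
    (hBv : ∀ Z t φ B b, Wt.Bv (emb Z t φ B) (ιb Z t b) = (B b : ℂ))
    (hBv0 : ∀ Z t φ B b', b' ∉ Set.range (ιb Z t) → Wt.Bv (emb Z t φ B) b' = 0)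
    (hVr : ∀ Z, ∀ t ∈ terms L M₃ Z, ∀ φ ∈ Wt.sp2 Z, ∀ Y ∈ Dfam Z t, ∀ B,
      emb Z t φ B ∈ Wt.sp1 Y → Vr Z t φ Y B = Wt.V Y (emb Z t φ B))
    (hχsupp : ∀ Z, ∀ t ∈ terms L M₃ Z, ∀ φ ∈ Wt.sp2 Z, ∀ B, χY₀ Z t B ≠ 0 → ∀ Y ∈ Dfam Z t,
      emb Z t φ B ∈ Wt.sp1 Y)
    -- (3) separate holomorphy of the X-integral in (σ, τ)
    (hΨσ : ∀ Z, ∀ t ∈ terms L M₃ Z, ∀ φ ∈ Wt.sp2 Z, ∀ τ : TDom 4 (L * (𝓣 s₀).N') → ℂ, (∀ j, τ j ∈ Uτ) →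
      SepHolOn Uσ (fun σ => core214 (fun σ => ((𝓣 s₀).𝒦 (idx Z t)).A2 σ (uOf Z t φ)) (Γm Z t φ)
        (F214 t.2.card (χY₀ Z t) (χcP Z t) (Dfam Z t) (Vr Z t φ)) σ τ))
    (hΨτ : ∀ Z, ∀ t ∈ terms L M₃ Z, ∀ φ ∈ Wt.sp2 Z, ∀ σ : TPt 4 (𝓣 s₀).N' → ℂ, (∀ j, σ j ∈ Uσ) →
      SepHolOn Uτ (fun τ => core214 (fun σ => ((𝓣 s₀).𝒦 (idx Z t)).A2 σ (uOf Z t φ)) (Γm Z t φ)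
        (F214 t.2.card (χY₀ Z t) (χcP Z t) (Dfam Z t) (Vr Z t φ)) σ τ))
    -- (3) NODE A's structural inputs at the configuration: A(σ) COMPLEX SYMMETRIC on the polydisc; Γ(σ) = G(σ)·
    (hAs : ∀ Z, ∀ t ∈ terms L M₃ Z, ∀ φ ∈ Wt.sp2 Z, ∀ σ : TPt 4 (𝓣 s₀).N' → ℂ, (∀ j, ‖σ j‖ ≤ Real.exp c.κ₁) →
      (((𝓣 s₀).𝒦 (idx Z t)).A2 σ (uOf Z t φ)).IsSymm)
    (hlin : ∀ Z, ∀ t ∈ terms L M₃ Z, ∀ φ ∈ Wt.sp2 Z, ∀ σ : TPt 4 (𝓣 s₀).N' → ℂ, (∀ j, ‖σ j‖ ≤ Real.exp c.κ₁) →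
      ∀ X : ((𝓣 s₀).𝒦 (idx Z t)).Λ ⊕ ((𝓣 s₀).𝒦 (idx Z t)).C₀ → ℝ, Γm Z t φ σ X = ((𝓣 s₀).𝒦 (idx Z t)).G2 σ (uOf Z t φ) *ᵥ fun j => (X j : ℂ))
    {γ₂ : ℝ} (hγ₂ : 0 ≤ γ₂)
    -- (3) uniform fibre bounds of the bond locations
    {m : ℕ}
    (hfibΛ : ∀ Z t (x : UT (𝓣 s₀).Nf), (Finset.univ.filter fun i => ((𝓣 s₀).𝒦 (idx Z t)).locΛ i = x).card ≤ m)
    (hfibN : ∀ Z t (x : UT (𝓣 s₀).Nf), (Finset.univ.filter fun j => ((𝓣 s₀).𝒦 (idx Z t)).locN j = x).card ≤ m)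
    -- (3) THE RUNG's PACKAGE: admissible with positive rates, `η ≤ etaMax` (standard rate book, `κ_C = q.kapCStar`,
    --     `ρ′ = q.mu/4`), `α < R`, round letters, and PRINT's TWO THRESHOLDS for a `θ₀ > 0`
    (hq : q.Admissible) (hp : q.PositiveRates) (hη : q.η ≤ q.etaMax) (hαR : α < q.R)
    {KG KCs θ₀ : ℝ} (hKG : q.Kbar ≤ KG) (hKCs : 4 / q.mA ≤ KCs) (hθ₀ : 0 < θ₀)
    (hαsmall : α ≤ θ₀ * q.R / (4 * q.Kbar + 4))
    (hRσlarge : Real.log ((4 * q.Kbar + 4) / θ₀) / (q.mu / 4 - q.kapCStar) ≤ q.Rσ)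
    -- (3) rates below the rung's κ_C⋆, and NODE A's letter ϑ (θ_Γ = θ_E = θ₀, K_Γ = K_G, K₀′ = K_Cs, θ_C derived)
    {kap kap' kap'' kap₂ ϑ : ℝ} (hkap'' : 0 < kap'') (hk1 : kap'' < kap') (hk2 : kap' < kap) (hk3 : kap < kap₂)
    (hk4 : kap₂ < q.kapCStar) (hθ₀le : θ₀ ≤ ϑ)
    (hθR1le : (m * (1 + 2 / (kap - kap')) ^ (𝓣 s₀).ν) * (m * (1 + 2 / (kap' - kap'')) ^ (𝓣 s₀).ν)
      * (θ₀ * KCs * KG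
        + KG * (KCs * θ₀ * (m * (1 + 2 / (q.kapCStar - kap₂)) ^ (𝓣 s₀).ν) * KCs
          * (m * (1 + 2 / (kap₂ - kap)) ^ (𝓣 s₀).ν)) * KG
        + KG * KCs * θ₀) ≤ ϑ)
    (hsmallKθ : KCs * (m * (1 + 2 / kap) ^ (𝓣 s₀).ν) * (ϑ * (m * (1 + 2 / kap'') ^ (𝓣 s₀).ν)) < 1)
    -- (3) the (2.24)–(2.25) smallness with `a₂₀ = m′·α₄·M⁻⁴(1 + 32/(κ₁−1))⁴`; `1∕m_A ≤ cE`; the form bound of Γ₀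
    {cE gq : ℝ} (hc0 : 0 ≤ cE)
    (hcE : 1 / q.mA ≤ cE)
    (hαc : (2 * (ϑ * (m * (1 + 2 / kap'') ^ (𝓣 s₀).ν)) +
      (γ₂ + m' * c.α₄ * (c.M ^ 4)⁻¹ * (1 + 32 / (c.κ₁ - 1)) ^ 4)) * cE ≤ 1 / 2) (hgq : 0 ≤ gq)
    (hΓq : ∀ Z, ∀ t ∈ terms L M₃ Z, ∀ X : ((𝓣 s₀).𝒦 (idx Z t)).Λ ⊕ ((𝓣 s₀).𝒦 (idx Z t)).C₀ → ℝ,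
      (((𝓣 s₀).𝒦 (idx Z t)).Γ₀ *ᵥ X) ⬝ᵥ (((𝓣 s₀).𝒦 (idx Z t)).C *ᵥ (((𝓣 s₀).𝒦 (idx Z t)).Γ₀ *ᵥ X)) ≤ gq * (X ⬝ᵥ X))
    (hsmall : (2 * (ϑ * (m * (1 + 2 / kap'') ^ (𝓣 s₀).ν)) +
      (γ₂ + m' * c.α₄ * (c.M ^ 4)⁻¹ * (1 + 32 / (c.κ₁ - 1)) ^ 4)) * (1 + 2 * cE * gq) ≤ 1 / 2)
    -- (3) constant matching, p. 17: `a ≤ γ₂ r_P²` and the volume factor with `w = K₀(64,8)·α₄·#(⋃𝐃)`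
    (hPa : a ≤ γ₂ * rP ^ 2)
    (hvol : ∀ Z, ∀ t ∈ terms L M₃ Z,
      2 * (KCs * (m * (1 + 2 / kap) ^ (𝓣 s₀).ν) * (ϑ * (m * (1 + 2 / kap'') ^ (𝓣 s₀).ν))
              * (1 + (1 - KCs * (m * (1 + 2 / kap) ^ (𝓣 s₀).ν) * (ϑ * (m * (1 + 2 / kap'') ^ (𝓣 s₀).ν)))⁻¹) / 2)
          * (Fintype.card ((𝓣 s₀).𝒦 (idx Z t)).Λ : ℝ)
        + K₀ 64 8 * c.α₄ * ((((Dfam Z t).image Subtype.val).biUnion id).card : ℝ)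
        + (2 * (ϑ * (m * (1 + 2 / kap'') ^ (𝓣 s₀).ν)) +
            (γ₂ + m' * c.α₄ * (c.M ^ 4)⁻¹ * (1 + 32 / (c.κ₁ - 1)) ^ 4)) * cE * (Fintype.card ((𝓣 s₀).𝒦 (idx Z t)).Λ : ℝ)
        + (2 * (ϑ * (m * (1 + 2 / kap'') ^ (𝓣 s₀).ν)) +
            (γ₂ + m' * c.α₄ * (c.M ^ 4)⁻¹ * (1 + 32 / (c.κ₁ - 1)) ^ 4)) * (1 + 2 * cE * gq)
            * (Fintype.card (((𝓣 s₀).𝒦 (idx Z t)).Λ ⊕ ((𝓣 s₀).𝒦 (idx Z t)).C₀) : ℝ)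
        ≤ a₅ * ((Z.1).card : ℝ)) :
    Dag.B13_main (leavesP w P) :=
  b13_main_at_stage11_rebindS13 F N θ₁₁ S c w P hup (hS ▸
    b13Leaf_twoTorus_uniformWalksAcross₂ c 𝓣 hall s₀ Wt k hN12 hL8 hLc S0 Fc Sq SX T Sc Sq' SX' T' dist h133 hS0Y hFsub
      hSq hScY hdist0 hdist hSX hSX' hX0 hAdd hZero hAnT hAnT' hK hK' hκ hδ1 hδκ hκ126 hκ126' hκ₁ hκ₁' hδ₀M hδ₀M5 hR8
      hR9 h124 h130 hθ0 hθ1 hC Gl hVpp hGlAn hGl rd e he hrd s Wf hg hK₂ hR h3 hW hKW hcard hV hQ hsp hvolk hfloor hAnP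
      hG M₃ hN h12 hE hε hC₁ hα hM hτ2 hUσ hUτ hUexp hUtau hr hr' hsubτ idx uOf hαnn huα lZ hlZ lD hlD Γm χY₀ χcP hχ0
      hχ1 Pl hPcard hrP hχc Dfam Vr hH ιb hι cube hQsupp hfibc emb hBv hBv0 hVr hχsupp hΨσ hΨτ hAs hlin hγ₂ hfibΛ hfibN
      hq hp hη hαR hKG hKCs hθ₀ hαsmall hRσlarge hkap'' hk1 hk2 hk3 hk4 hθ₀le hθR1le hsmallKθ hc0 hcE hαc hgq hΓq
      hsmall hPa hvol)

end Summit.QuantumFields.YangMills.BalabanUVNodes.N10AtRecord11Walks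

end
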